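import Summits.NavierStokesRegularity.FunctionalMining.NoGo.TopBotEigSplitShareClosure
import Summits.NavierStokesRegularity.FunctionalMining.NoGo.TopBotEigSplitWallOneDim
import Summits.NavierStokesRegularity.FunctionalMining.NoGo.TopBotEigSplitShareWallMain
import HarnessLib

/-!
# K20b — the share WINDOW: `Iic (c_axi(q))` modulo (N⁺)(D)(W) for every real `q > 1`;
# `Iic (2/9)` at `q = 4` and `Iic (1/3)` at `q = 2` unconditionally

search for candidate a priori estimates; no regularity claim.

No-go branch (door D-K6 (c)), kernel side. Packaging of K16 (necessity `c ≤ cAxi q`,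
`NoGo/TopBotEigSplitShareWallMain`), K19 (sufficiency from three one-variable sign conditions,
`NoGo/TopBotEigSplitWallOneDim`), K17 (the sharp `2/9` at `q = 4`) and K20a (downward closure,
`NoGo/TopBotEigSplitShareClosure`):

* §1 every real `q > 1`: if (N⁺), (D), (W) hold at `c = cAxi q` on `[1/3, 2/3]`, then
  `IsGreatest {c | TopBotEigSplitting q c} (cAxi q)`, `{c | TopBotEigSplitting q c} = Iic (cAxi q)`,
  `TopBotEigSplitting q c ↔ c ≤ cAxi q`, `sSup {c | TopBotEigSplitting q c} = cAxi q`.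
* §2 `q = 4` unconditionally: `{c | TopBotEigSplitting 4 c} = Iic (2/9)`,
  `TopBotEigSplitting 4 c ↔ c ≤ 2/9`.
* §3 `q = 2` unconditionally, through K19's criterion (census-1 remark R-K19-A1: at `(2, 1/3)` the
  closed forms give `N ≡ 1/3`, `N′ ≡ N″ ≡ T ≡ 0`): `TopBotEigSplitting 2 (1/3)`,
  `{c | TopBotEigSplitting 2 c} = Iic (1/3)`, `TopBotEigSplitting 2 c ↔ c ≤ 1/3`.
* §4 every real `q ≥ 2`: the bracket
  `Iic (shareConst q) ⊆ {c | TopBotEigSplitting q c} ⊆ Iic (cAxi q)`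
  (tree K10c + K16), unconditionally.

NOT claimed: (N⁺)/(D)/(W) for any `q ∉ {2, 4}`; nothing on `heatDissipation`,
`TopEigHeatCoercivePos`, `NegBotEigHeatCoercivePos`; the verdict of record L-λ(q) stays OPEN (kernel)
for every real `q > 1`.
[ours, packaging]
FILING (prove seat g26, REQUEST #36 (K20b: nogo g43 touch 6, HOME INBOX l.4713; LEAD RULING (λλ)(ii) l.4721: slot #36 LOW after #34 ✓ ∧ #31′ part 2 ✓ ∧ #35 ✓)): declarations byte-identical to the no-go seat's staged `TopBotEigSplitShareWindow.STAGING.lean` 2686b454667cacb3; this line is the only addition.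
-/

noncomputable section

open Set Real

namespace Summit.NavierStokesRegularity.FunctionalMining

namespace TopEig

/-! ## 1. The window modulo (N⁺) ∧ (D) ∧ (W) at `c = c_axi(q)`, every real `q > 1` -/

section window

/-- **The share window is `Iic (c_axi(q))` modulo three one-variable sign conditions**, every real
`q > 1`: if K19's hypotheses (N⁺), (D), (W) hold at `c = cAxi q` on `[1/3, 2/3]`, then `cAxi q` is
the
GREATEST splitting share (K16 necessity + K19 sufficiency). [ours; packaging] -/
theorem topBotEigSplitting_isGreatest_of_line {q : ℝ} (hq : 1 < q)
    (hN : ∀ ⦃u : ℝ⦄, 1 / 3 ≤ u → u ≤ 2 / 3 → 0 < lineN q (cAxi q) u)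
    (hD : ∀ ⦃u : ℝ⦄, 1 / 3 ≤ u → u ≤ 2 / 3 →
      cAxi q * (3 * u - 1) * lineNsq u ^ (q / 2 - 1) ≤ u ^ (q - 1))
    (hT : ∀ ⦃u : ℝ⦄, 1 / 3 < u → u < 2 / 3 → 0 ≤ lineT q (cAxi q) u) :
    IsGreatest {c : ℝ | TopBotEigSplitting q c} (cAxi q) :=
  ⟨topBotEigSplitting_of_line hq.le (cAxi_pos hq).le hN hD hT,
    fun _ hc => topBotEigSplitting_share_le_cAxi hq hc⟩

/-- **Window theorem modulo (N⁺)(D)(W)**, every real `q > 1`: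
`{c | TopBotEigSplitting q c} = Iic (cAxi q)`. [ours; packaging + downward closure] -/
theorem topBotEigSplitting_window_of_line {q : ℝ} (hq : 1 < q)
    (hN : ∀ ⦃u : ℝ⦄, 1 / 3 ≤ u → u ≤ 2 / 3 → 0 < lineN q (cAxi q) u)
    (hD : ∀ ⦃u : ℝ⦄, 1 / 3 ≤ u → u ≤ 2 / 3 →
      cAxi q * (3 * u - 1) * lineNsq u ^ (q / 2 - 1) ≤ u ^ (q - 1))
    (hT : ∀ ⦃u : ℝ⦄, 1 / 3 < u → u < 2 / 3 → 0 ≤ lineT q (cAxi q) u) :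
    {c : ℝ | TopBotEigSplitting q c} = Iic (cAxi q) :=
  topBotEigSplitting_window_of_isGreatest hq.le (topBotEigSplitting_isGreatest_of_line hq hN hD hT)

/-- Pointwise form: modulo (N⁺)(D)(W) at `c_axi(q)`, `TopBotEigSplitting q c ↔ c ≤ cAxi q`.
[ours; packaging] -/
theorem topBotEigSplitting_iff_le_cAxi_of_line {q : ℝ} (hq : 1 < q)
    (hN : ∀ ⦃u : ℝ⦄, 1 / 3 ≤ u → u ≤ 2 / 3 → 0 < lineN q (cAxi q) u)
    (hD : ∀ ⦃u : ℝ⦄, 1 / 3 ≤ u → u ≤ 2 / 3 →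
      cAxi q * (3 * u - 1) * lineNsq u ^ (q / 2 - 1) ≤ u ^ (q - 1))
    (hT : ∀ ⦃u : ℝ⦄, 1 / 3 < u → u < 2 / 3 → 0 ≤ lineT q (cAxi q) u) (c : ℝ) :
    TopBotEigSplitting q c ↔ c ≤ cAxi q := by
  have h := topBotEigSplitting_window_of_line hq hN hD hT
  exact ⟨fun hc => (h ▸ (show c ∈ {c : ℝ | TopBotEigSplitting q c} from hc) : c ∈ Iic (cAxi q)),
    fun hc =>
      topBotEigSplitting_of_le hq.le hc (topBotEigSplitting_isGreatest_of_line hq hN hD hT).1⟩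

/-- The supremum form, modulo (N⁺)(D)(W): `sSup {c | TopBotEigSplitting q c} = cAxi q`.
[ours; packaging] -/
theorem sSup_topBotEigSplitting_of_line {q : ℝ} (hq : 1 < q)
    (hN : ∀ ⦃u : ℝ⦄, 1 / 3 ≤ u → u ≤ 2 / 3 → 0 < lineN q (cAxi q) u)
    (hD : ∀ ⦃u : ℝ⦄, 1 / 3 ≤ u → u ≤ 2 / 3 →
      cAxi q * (3 * u - 1) * lineNsq u ^ (q / 2 - 1) ≤ u ^ (q - 1))
    (hT : ∀ ⦃u : ℝ⦄, 1 / 3 < u → u < 2 / 3 → 0 ≤ lineT q (cAxi q) u) :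
    sSup {c : ℝ | TopBotEigSplitting q c} = cAxi q :=
  (topBotEigSplitting_isGreatest_of_line hq hN hD hT).csSup_eq

end window

/-! ## 2. `q = 4`: the window is `Iic (2/9)`, unconditionally -/

section four

/-- **The `q = 4` share window is exactly `(-∞, 2/9]`**: `{c | TopBotEigSplitting 4 c} = Iic (2/9)`
(tree K14 `topBotEigSplitting_four_share_le`, K17 `topBotEigSplitting_four_sharp`, and the downward
closure of K20a). [ours] -/
theorem topBotEigSplitting_four_window : {c : ℝ | TopBotEigSplitting 4 c} = Iic (2 / 9) :=
  topBotEigSplitting_window_of_isGreatest (by norm_num) topBotEigSplitting_four_isGreatest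

/-- Pointwise form at `q = 4`: `TopBotEigSplitting 4 c ↔ c ≤ 2/9`. [ours] -/
theorem topBotEigSplitting_four_iff (c : ℝ) : TopBotEigSplitting 4 c ↔ c ≤ 2 / 9 :=
  ⟨fun hc => topBotEigSplitting_four_share_le hc,
    fun hc => topBotEigSplitting_of_le (by norm_num) hc topBotEigSplitting_four_sharp⟩

/-- In particular every share `c ≤ 2/9` splits at `q = 4` (e.g. K10c's `1/999`-type shares and the
sharp `2/9` are joined by an interval). [ours, bookkeeping] -/
theorem topBotEigSplitting_four_of_le {c : ℝ} (hc : c ≤ 2 / 9) : TopBotEigSplitting 4 c :=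
  (topBotEigSplitting_four_iff c).2 hc

/-- Consistency with K16's window notation: `{c | TopBotEigSplitting 4 c} = Iic (cAxi 4)`.
[ours, bookkeeping; `cAxi_four`] -/
theorem topBotEigSplitting_four_window_cAxi : {c : ℝ | TopBotEigSplitting 4 c} = Iic (cAxi 4) := by
  rw [cAxi_four]; exact topBotEigSplitting_four_window

end four

/-! ## 3. `q = 2`: the window is `Iic (1/3)`, unconditionally (census-1 remark R-K19-A1) -/

section two

/-- At `q = 2`, `c = 1/3`: `N ≡ 1/3` (K7's pointwise identity in closed form). [ours, by value] -/
theorem lineN_two (u : ℝ) : lineN 2 (1 / 3) u = 1 / 3 := by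
  have h1 : lineNsq u ^ ((2 : ℝ) / 2) = lineNsq u := by
    rw [show (2 : ℝ) / 2 = 1 by norm_num, Real.rpow_one]
  unfold lineN; rw [h1]; simp only [Real.rpow_two]; unfold lineNsq; ring

/-- At `q = 2`, `c = 1/3`: `N′ ≡ 0`. [ours, by value] -/
theorem lineN1_two (u : ℝ) : lineN1 2 (1 / 3) u = 0 := by
  unfold lineN1
  rw [show (2 : ℝ) - 1 = 1 by norm_num, show (2 : ℝ) / 2 - 1 = 0 by norm_num]
  simp only [Real.rpow_one, Real.rpow_zero]; ring

/-- At `q = 2`, `c = 1/3`: `N″ ≡ 0`. [ours, by value] -/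
theorem lineN2_two (u : ℝ) : lineN2 2 (1 / 3) u = 0 := by
  unfold lineN2
  rw [show (2 : ℝ) - 2 = 0 by norm_num, show (2 : ℝ) / 2 - 1 = 0 by norm_num]
  simp only [Real.rpow_zero]; ring

/-- At `q = 2`, `c = 1/3`: `T ≡ 0` — (W) holds with equality everywhere. [ours, by value] -/
theorem lineT_two (u : ℝ) : lineT 2 (1 / 3) u = 0 := by
  unfold lineT; rw [lineN1_two, lineN2_two]; ring

/-- **`TopBotEigSplitting 2 (1/3)`** through K19's one-dimensional criterion: (N⁺) `N ≡ 1/3 > 0`,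
(D) `u − 1/3 ≤ u`, (W) `T ≡ 0`. [ours; the criterion live at a second exponent] -/
theorem topBotEigSplitting_two_sharp : TopBotEigSplitting 2 (1 / 3) :=
  topBotEigSplitting_of_line (by norm_num) (by norm_num)
    (fun u _ _ => by rw [lineN_two]; norm_num)
    (fun u _ _ => by
      rw [show (2 : ℝ) / 2 - 1 = 0 by norm_num, show (2 : ℝ) - 1 = 1 by norm_num, Real.rpow_zero,
        Real.rpow_one]
      linarith)
    (fun u _ _ => by rw [lineT_two])

/-- **`1/3` is the greatest `q = 2` share** (K16 `cAxi_two` + necessity). [ours] -/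
theorem topBotEigSplitting_two_isGreatest :
    IsGreatest {c : ℝ | TopBotEigSplitting 2 c} (1 / 3) :=
  ⟨topBotEigSplitting_two_sharp,
    fun _ hc => cAxi_two ▸ topBotEigSplitting_share_le_cAxi (by norm_num) hc⟩

/-- **The `q = 2` share window is exactly `(-∞, 1/3]`**. [ours] -/
theorem topBotEigSplitting_two_window : {c : ℝ | TopBotEigSplitting 2 c} = Iic (1 / 3) :=
  topBotEigSplitting_window_of_isGreatest (by norm_num) topBotEigSplitting_two_isGreatest

/-- Pointwise form at `q = 2`: `TopBotEigSplitting 2 c ↔ c ≤ 1/3`. [ours] -/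
theorem topBotEigSplitting_two_iff (c : ℝ) : TopBotEigSplitting 2 c ↔ c ≤ 1 / 3 :=
  ⟨fun hc => topBotEigSplitting_two_isGreatest.2 hc,
    fun hc => topBotEigSplitting_of_le (by norm_num) hc topBotEigSplitting_two_sharp⟩

end two

/-! ## 4. The bracket for every real `q ≥ 2`, unconditionally -/

section bracket

/-- **`Iic (shareConst q) ⊆ {c | TopBotEigSplitting q c} ⊆ Iic (cAxi q)`**, every real `q ≥ 2`
(tree K10c + K20a downward closure; K16 necessity). [ours, packaging] -/
theorem window_bracket {q : ℝ} (hq : 2 ≤ q) :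
    Iic (shareConst q) ⊆ {c : ℝ | TopBotEigSplitting q c} ∧
      {c : ℝ | TopBotEigSplitting q c} ⊆ Iic (cAxi q) :=
  ⟨Iic_shareConst_subset_window hq, fun _ hc => topBotEigSplitting_share_le_cAxi (by linarith) hc⟩

/-- The window is a non-empty, bounded-above lower set for every real `q ≥ 2`; its supremum lies in
`[shareConst q, cAxi q]`. [ours, bookkeeping] -/
theorem sSup_window_mem_Icc {q : ℝ} (hq : 2 ≤ q) :
    sSup {c : ℝ | TopBotEigSplitting q c} ∈ Icc (shareConst q) (cAxi q) := by
  have hne : ({c : ℝ | TopBotEigSplitting q c}).Nonempty := ⟨_, topBotEigSplitting_of_shareConst hq⟩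
  have hbd : BddAbove {c : ℝ | TopBotEigSplitting q c} :=
    ⟨cAxi q, fun _ hc => topBotEigSplitting_share_le_cAxi (by linarith) hc⟩
  exact ⟨le_csSup hbd (topBotEigSplitting_of_shareConst hq),
    csSup_le hne fun _ hc => topBotEigSplitting_share_le_cAxi (by linarith) hc⟩

end bracket

end TopEig

end Summit.NavierStokesRegularity.FunctionalMining
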